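import Summits.FinalStateConjecture.FinalStateConjecture.Theorems.PhotonSphereChannelsFrozenPacketMain
import Literature.Geometry.Lorentzian.ReggeWheelerTortoise

/-!
# Route PhotonSphereChannels · K1R — explicit, `ℓ`-uniform bounds on the Regge–Wheeler potential on
# the horizon side (negative-side support for item stmt-FinalStateConjecture-14074)

For the tightness lemma "the log-ball rate `C` of K1R is at least the mass `M`" the constants of
`Blindness.potential_compact_bounds` must be explicit in the position of the interval, because the
near edge `x_c − ρ₀ − C log(ℓ+1)` recedes with `ℓ`.  This file proves, for a tortoise radius
function (`IsTortoiseRadius M r xc`):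

* `radius_sub_ge_exp`: `r(x) − 2M ≥ M e^{(x − x_c)/2M}` for `x ≤ x_c` (comparison for
  `(log (r − 2M))' = 1/r ≤ 1/2M`);
* `radius_le_three`, `radius_sub_le_sub`: `r ≤ 3M` left of the centre, `r` is `1`-Lipschitz;
* `potential_lipschitz_explicit`: `|V_ℓ(x) − V_ℓ(y)| ≤ (ℓ(ℓ+1) + 1)(3/M³)|x − y|` on all of `ℝ`
  (pure algebra in `u = r x`, `v = r y ≥ 2M`);
* `potential_lower_near`: on `[x_c − ρ − 3, x_c − ρ]`, `ρ ≥ 0`: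
  `V_ℓ ≥ ℓ(ℓ+1) e^{−(ρ+3)/2M}/(27M²) − 1/M²`.
No definitions are introduced.
-/

noncomputable section

open Set Filter Topology Function Real

namespace Summit.FinalStateConjecture.FinalStateConjecture.Theorems.UniformR

open Literature.Geometry.Lorentzian.ReggeWheeler

variable {M : ℝ} {r : ℝ → ℝ} {xc : ℝ}

/-- `r` is non-decreasing. -/
theorem radius_monotone (hr : IsTortoiseRadius M r xc) : Monotone r :=
  monotone_of_deriv_nonneg hr.differentiable fun x => by
    rw [hr.deriv_eq x]; exact (hr.deriv_pos x).le

/-- Left of the centre the radius is at most `3M`. -/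
theorem radius_le_three (hr : IsTortoiseRadius M r xc) {x : ℝ} (hx : x ≤ xc) : r x ≤ 3 * M := by
  have := radius_monotone hr hx
  rw [hr.center] at this
  exact this

/-- `r` is `1`-Lipschitz: `x ↦ x − r x` is non-decreasing (`r' < 1`). -/
theorem radius_sub_le_sub (hr : IsTortoiseRadius M r xc) {x y : ℝ} (hxy : x ≤ y) :
    r y - r x ≤ y - x := by
  have hmono : Monotone fun x => x - r x := by
    refine monotone_of_deriv_nonneg (differentiable_id.sub hr.differentiable) fun z => ?_
    have hd : HasDerivAt (fun x => x - r x) (1 - (1 - 2 * M / r z)) z :=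
      (hasDerivAt_id z).sub (hr.hasDerivAt z)
    rw [hd.deriv]
    have := hr.deriv_lt_one z
    linarith
  have := hmono hxy
  simp only at this
  linarith

/-- `|r x − r y| ≤ |x − y|`. -/
theorem abs_radius_sub_le (hr : IsTortoiseRadius M r xc) (x y : ℝ) : |r x - r y| ≤ |x - y| := by
  rcases le_total x y with h | h
  · have h1 := radius_sub_le_sub hr h
    have h2 : r x ≤ r y := radius_monotone hr h
    rw [abs_of_nonpos (by linarith), abs_of_nonpos (by linarith)]
    linarith
  · have h1 := radius_sub_le_sub hr h
    have h2 : r y ≤ r x := radius_monotone hr h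
    rw [abs_of_nonneg (by linarith), abs_of_nonneg (by linarith)]
    linarith

/-- **Exponential lower bound on the horizon side**: `r(x) − 2M ≥ M e^{(x − x_c)/(2M)}` for
`x ≤ x_c`, from `(log(r − 2M))' = 1/r ≤ 1/(2M)`. -/
theorem radius_sub_ge_exp (hr : IsTortoiseRadius M r xc) {x : ℝ} (hx : x ≤ xc) :
    M * Real.exp ((x - xc) / (2 * M)) ≤ r x - 2 * M := by
  have hM := hr.mass_pos
  have hpos : ∀ z, 0 < r z - 2 * M := hr.sub_pos
  -- `h(z) = log (r z − 2M) − z/(2M)` is non-increasing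
  set h : ℝ → ℝ := fun z => Real.log (r z - 2 * M) - z / (2 * M) with hh
  have hdiff : Differentiable ℝ h := by
    refine Differentiable.sub (fun z => ?_) (differentiable_id.div_const _)
    exact ((hr.differentiable z).sub_const _).log (hpos z).ne'
  have hderiv : ∀ z, deriv h z = 1 / r z - 1 / (2 * M) := by
    intro z
    have h1 : HasDerivAt (fun z => r z - 2 * M) (1 - 2 * M / r z) z := (hr.hasDerivAt z).sub_const _
    have h2 : HasDerivAt (fun z => Real.log (r z - 2 * M)) ((1 - 2 * M / r z) / (r z - 2 * M)) z :=
      h1.log (hpos z).ne'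
    have h3 : HasDerivAt (fun z : ℝ => z / (2 * M)) (1 / (2 * M)) z := by
      simpa using (hasDerivAt_id z).div_const (2 * M)
    have h4 : HasDerivAt h ((1 - 2 * M / r z) / (r z - 2 * M) - 1 / (2 * M)) z := h2.sub h3
    rw [h4.deriv]
    have hrz : r z ≠ 0 := (hr.pos z).ne'
    have hsz : r z - 2 * M ≠ 0 := (hpos z).ne'
    field_simp
  have hanti : Antitone h := by
    refine antitone_of_deriv_nonpos hdiff fun z => ?_
    rw [hderiv z]
    have hrz := hr.two_mul_lt z
    have hrp := hr.pos z
    rw [sub_nonpos, one_div_le_one_div hrp (by linarith)]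
    exact hrz.le
  have key := hanti hx
  -- unfold at `xc`: `r xc − 2M = M`
  have hc : r xc - 2 * M = M := by rw [hr.center]; ring
  simp only [hh, hc] at key
  -- `log M − xc/(2M) ≤ log (r x − 2M) − x/(2M)`
  have hlog : Real.log M + (x - xc) / (2 * M) ≤ Real.log (r x - 2 * M) := by
    have : (x - xc) / (2 * M) = x / (2 * M) - xc / (2 * M) := by ring
    rw [this]
    linarith
  have := Real.exp_le_exp.2 hlog
  rwa [Real.exp_add, Real.exp_log hM, Real.exp_log (hpos x)] at this

/-- **Explicit global Lipschitz bound**, uniform in `ℓ`: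
`|V_ℓ(x) − V_ℓ(y)| ≤ (ℓ(ℓ+1) + 1) (3/M³) |x − y|` for the spin-2 Regge–Wheeler potential along a
tortoise radius function.  (Algebra in `u = r x`, `v = r y ≥ 2M`: `F(u) = (u − 2M)/u³` has
`|F(u) − F(v)| ≤ (5/(8M³))|u − v|`, `G(u) = 6M(u − 2M)/u⁴` has `|G(u) − G(v)| ≤ (21/(8M³))|u − v|`,
and `|u − v| ≤ |x − y|`.) -/
theorem potential_lipschitz_explicit (hr : IsTortoiseRadius M r xc) (ℓ : ℕ) (x y : ℝ) :
    |(1 - 2 * M / r x) *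
        ((ℓ : ℝ) * ((ℓ : ℝ) + 1) / r x ^ 2 + (1 - ((2 : ℕ) : ℝ) ^ 2) * (2 * M) / r x ^ 3)
      - (1 - 2 * M / r y) *
        ((ℓ : ℝ) * ((ℓ : ℝ) + 1) / r y ^ 2 + (1 - ((2 : ℕ) : ℝ) ^ 2) * (2 * M) / r y ^ 3)|
      ≤ ((ℓ : ℝ) * ((ℓ : ℝ) + 1) + 1) * (3 / M ^ 3) * |x - y| := by
  have hM := hr.mass_pos
  set u := r x with hu
  set v := r y with hv
  have hu2 : 2 * M < u := hr.two_mul_lt x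
  have hv2 : 2 * M < v := hr.two_mul_lt y
  have hu0 : 0 < u := by linarith
  have hv0 : 0 < v := by linarith
  set L : ℝ := (ℓ : ℝ) * ((ℓ : ℝ) + 1) with hL
  have hL0 : 0 ≤ L := by positivity
  -- rewrite both potentials as `L F + (−G)` with `F = (u−2M)/u³`, `G = 6M(u−2M)/u⁴`
  have hsplit : ∀ w : ℝ, w ≠ 0 → (1 - 2 * M / w) *
      (L / w ^ 2 + (1 - ((2 : ℕ) : ℝ) ^ 2) * (2 * M) / w ^ 3)
      = L * ((w - 2 * M) / w ^ 3) - 6 * M * (w - 2 * M) / w ^ 4 := by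
    intro w hw
    push_cast
    field_simp
    ring
  rw [hsplit u hu0.ne', hsplit v hv0.ne']
  -- Lipschitz bounds for F and G in the radius variable
  have hF : |(u - 2 * M) / u ^ 3 - (v - 2 * M) / v ^ 3| ≤ 5 / (8 * M ^ 3) * |u - v| := by
    have hid : (u - 2 * M) / u ^ 3 - (v - 2 * M) / v ^ 3
        = (v - u) * (u * v * (u + v) - 2 * M * (u ^ 2 + u * v + v ^ 2)) / (u ^ 3 * v ^ 3) := by
      field_simp
      ring
    rw [hid, abs_div, abs_mul, abs_of_pos (by positivity : (0:ℝ) < u ^ 3 * v ^ 3), abs_sub_comm v u]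
    rw [div_le_iff₀ (by positivity)]
    have hA : |u * v * (u + v) - 2 * M * (u ^ 2 + u * v + v ^ 2)|
        ≤ u * v * (u + v) + 2 * M * (u ^ 2 + u * v + v ^ 2) := by
      refine (abs_sub _ _).trans ?_
      rw [abs_of_pos (by positivity), abs_of_pos (by positivity)]
    have hB : u * v * (u + v) + 2 * M * (u ^ 2 + u * v + v ^ 2)
        ≤ 5 / (8 * M ^ 3) * (u ^ 3 * v ^ 3) := by
      rw [div_mul_eq_mul_div, le_div_iff₀ (by positivity)]
      have huv4 : 4 * M ^ 2 ≤ u * v := by nlinarith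
      have huvM : M * (u + v) ≤ u * v := by nlinarith
      have hT1 : 4 * M ^ 3 * (u * v * (u + v)) ≤ u ^ 3 * v ^ 3 := by
        have h1 : 4 * M ^ 3 * (u + v) ≤ u * v * (u * v) := by
          calc 4 * M ^ 3 * (u + v) = 4 * M ^ 2 * (M * (u + v)) := by ring
            _ ≤ (u * v) * (u * v) := mul_le_mul huv4 huvM (by positivity) (by positivity)
        calc 4 * M ^ 3 * (u * v * (u + v)) = (u * v) * (4 * M ^ 3 * (u + v)) := by ring
          _ ≤ (u * v) * (u * v * (u * v)) := mul_le_mul_of_nonneg_left h1 (by positivity)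
          _ = u ^ 3 * v ^ 3 := by ring
      have pu := fun n : ℕ => pow_le_pow_left₀ (by linarith : (0:ℝ) ≤ 2 * M) hu2.le n
      have pv := fun n : ℕ => pow_le_pow_left₀ (by linarith : (0:ℝ) ≤ 2 * M) hv2.le n
      have h16a : 16 * M ^ 4 ≤ u * v ^ 3 := by
        calc 16 * M ^ 4 = (2 * M) * (2 * M) ^ 3 := by ring
          _ ≤ u * v ^ 3 := mul_le_mul hu2.le (pv 3) (by positivity) (by positivity)
      have h16b : 16 * M ^ 4 ≤ u ^ 2 * v ^ 2 := by
        calc 16 * M ^ 4 = (2 * M) ^ 2 * (2 * M) ^ 2 := by ring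
          _ ≤ u ^ 2 * v ^ 2 := mul_le_mul (pu 2) (pv 2) (by positivity) (by positivity)
      have h16c : 16 * M ^ 4 ≤ u ^ 3 * v := by
        calc 16 * M ^ 4 = (2 * M) ^ 3 * (2 * M) := by ring
          _ ≤ u ^ 3 * v := mul_le_mul (pu 3) hv2.le (by positivity) (by positivity)
      have e1 : 16 * M ^ 4 * u ^ 2 ≤ u ^ 3 * v ^ 3 := by
        calc 16 * M ^ 4 * u ^ 2 ≤ (u * v ^ 3) * u ^ 2 := mul_le_mul_of_nonneg_right h16a (by positivity)
          _ = u ^ 3 * v ^ 3 := by ring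
      have e2 : 16 * M ^ 4 * (u * v) ≤ u ^ 3 * v ^ 3 := by
        calc 16 * M ^ 4 * (u * v) ≤ (u ^ 2 * v ^ 2) * (u * v) := mul_le_mul_of_nonneg_right h16b (by positivity)
          _ = u ^ 3 * v ^ 3 := by ring
      have e3 : 16 * M ^ 4 * v ^ 2 ≤ u ^ 3 * v ^ 3 := by
        calc 16 * M ^ 4 * v ^ 2 ≤ (u ^ 3 * v) * v ^ 2 := mul_le_mul_of_nonneg_right h16c (by positivity)
          _ = u ^ 3 * v ^ 3 := by ring
      nlinarith [hT1, e1, e2, e3]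
    calc |u - v| * |u * v * (u + v) - 2 * M * (u ^ 2 + u * v + v ^ 2)|
        ≤ |u - v| * (5 / (8 * M ^ 3) * (u ^ 3 * v ^ 3)) :=
          mul_le_mul_of_nonneg_left (hA.trans hB) (abs_nonneg _)
      _ = 5 / (8 * M ^ 3) * |u - v| * (u ^ 3 * v ^ 3) := by ring
  have hG : |6 * M * (u - 2 * M) / u ^ 4 - 6 * M * (v - 2 * M) / v ^ 4|
      ≤ 21 / (8 * M ^ 3) * |u - v| := by
    have hid : 6 * M * (u - 2 * M) / u ^ 4 - 6 * M * (v - 2 * M) / v ^ 4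
        = (v - u) * (6 * M * (u * v * (u ^ 2 + u * v + v ^ 2) - 2 * M * (u + v) * (u ^ 2 + v ^ 2)))
          / (u ^ 4 * v ^ 4) := by
      field_simp
      ring
    rw [hid, abs_div, abs_mul, abs_of_pos (by positivity : (0:ℝ) < u ^ 4 * v ^ 4), abs_sub_comm v u]
    rw [div_le_iff₀ (by positivity)]
    have hA : |6 * M * (u * v * (u ^ 2 + u * v + v ^ 2) - 2 * M * (u + v) * (u ^ 2 + v ^ 2))|
        ≤ 6 * M * (u * v * (u ^ 2 + u * v + v ^ 2) + 2 * M * (u + v) * (u ^ 2 + v ^ 2)) := by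
      rw [abs_mul, abs_of_pos (by positivity : (0:ℝ) < 6 * M)]
      refine mul_le_mul_of_nonneg_left ((abs_sub _ _).trans ?_) (by positivity)
      rw [abs_of_pos (by positivity), abs_of_pos (by positivity)]
    have hB : 6 * M * (u * v * (u ^ 2 + u * v + v ^ 2) + 2 * M * (u + v) * (u ^ 2 + v ^ 2))
        ≤ 21 / (8 * M ^ 3) * (u ^ 4 * v ^ 4) := by
      rw [div_mul_eq_mul_div, le_div_iff₀ (by positivity)]
      have pu := fun n : ℕ => pow_le_pow_left₀ (by linarith : (0:ℝ) ≤ 2 * M) hu2.le n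
      have pv := fun n : ℕ => pow_le_pow_left₀ (by linarith : (0:ℝ) ≤ 2 * M) hv2.le n
      have h16a : 16 * M ^ 4 ≤ u * v ^ 3 := by
        calc 16 * M ^ 4 = (2 * M) * (2 * M) ^ 3 := by ring
          _ ≤ u * v ^ 3 := mul_le_mul hu2.le (pv 3) (by positivity) (by positivity)
      have h16b : 16 * M ^ 4 ≤ u ^ 2 * v ^ 2 := by
        calc 16 * M ^ 4 = (2 * M) ^ 2 * (2 * M) ^ 2 := by ring
          _ ≤ u ^ 2 * v ^ 2 := mul_le_mul (pu 2) (pv 2) (by positivity) (by positivity)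
      have h16c : 16 * M ^ 4 ≤ u ^ 3 * v := by
        calc 16 * M ^ 4 = (2 * M) ^ 3 * (2 * M) := by ring
          _ ≤ u ^ 3 * v := mul_le_mul (pu 3) hv2.le (by positivity) (by positivity)
      have h32a : 32 * M ^ 5 ≤ u * v ^ 4 := by
        calc 32 * M ^ 5 = (2 * M) * (2 * M) ^ 4 := by ring
          _ ≤ u * v ^ 4 := mul_le_mul hu2.le (pv 4) (by positivity) (by positivity)
      have h32b : 32 * M ^ 5 ≤ u ^ 3 * v ^ 2 := by
        calc 32 * M ^ 5 = (2 * M) ^ 3 * (2 * M) ^ 2 := by ring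
          _ ≤ u ^ 3 * v ^ 2 := mul_le_mul (pu 3) (pv 2) (by positivity) (by positivity)
      have h32c : 32 * M ^ 5 ≤ u ^ 2 * v ^ 3 := by
        calc 32 * M ^ 5 = (2 * M) ^ 2 * (2 * M) ^ 3 := by ring
          _ ≤ u ^ 2 * v ^ 3 := mul_le_mul (pu 2) (pv 3) (by positivity) (by positivity)
      have h32d : 32 * M ^ 5 ≤ u ^ 4 * v := by
        calc 32 * M ^ 5 = (2 * M) ^ 4 * (2 * M) := by ring
          _ ≤ u ^ 4 * v := mul_le_mul (pu 4) hv2.le (by positivity) (by positivity)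
      have e1 : 16 * M ^ 4 * (u ^ 3 * v) ≤ u ^ 4 * v ^ 4 := by
        calc 16 * M ^ 4 * (u ^ 3 * v) ≤ (u * v ^ 3) * (u ^ 3 * v) := mul_le_mul_of_nonneg_right h16a (by positivity)
          _ = u ^ 4 * v ^ 4 := by ring
      have e2 : 16 * M ^ 4 * (u ^ 2 * v ^ 2) ≤ u ^ 4 * v ^ 4 := by
        calc 16 * M ^ 4 * (u ^ 2 * v ^ 2) ≤ (u ^ 2 * v ^ 2) * (u ^ 2 * v ^ 2) :=
              mul_le_mul_of_nonneg_right h16b (by positivity)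
          _ = u ^ 4 * v ^ 4 := by ring
      have e3 : 16 * M ^ 4 * (u * v ^ 3) ≤ u ^ 4 * v ^ 4 := by
        calc 16 * M ^ 4 * (u * v ^ 3) ≤ (u ^ 3 * v) * (u * v ^ 3) := mul_le_mul_of_nonneg_right h16c (by positivity)
          _ = u ^ 4 * v ^ 4 := by ring
      have f1 : 32 * M ^ 5 * u ^ 3 ≤ u ^ 4 * v ^ 4 := by
        calc 32 * M ^ 5 * u ^ 3 ≤ (u * v ^ 4) * u ^ 3 := mul_le_mul_of_nonneg_right h32a (by positivity)
          _ = u ^ 4 * v ^ 4 := by ring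
      have f2 : 32 * M ^ 5 * (u * v ^ 2) ≤ u ^ 4 * v ^ 4 := by
        calc 32 * M ^ 5 * (u * v ^ 2) ≤ (u ^ 3 * v ^ 2) * (u * v ^ 2) := mul_le_mul_of_nonneg_right h32b (by positivity)
          _ = u ^ 4 * v ^ 4 := by ring
      have f3 : 32 * M ^ 5 * (u ^ 2 * v) ≤ u ^ 4 * v ^ 4 := by
        calc 32 * M ^ 5 * (u ^ 2 * v) ≤ (u ^ 2 * v ^ 3) * (u ^ 2 * v) := mul_le_mul_of_nonneg_right h32c (by positivity)
          _ = u ^ 4 * v ^ 4 := by ring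
      have f4 : 32 * M ^ 5 * v ^ 3 ≤ u ^ 4 * v ^ 4 := by
        calc 32 * M ^ 5 * v ^ 3 ≤ (u ^ 4 * v) * v ^ 3 := mul_le_mul_of_nonneg_right h32d (by positivity)
          _ = u ^ 4 * v ^ 4 := by ring
      nlinarith [e1, e2, e3, f1, f2, f3, f4]
    calc |u - v| * |6 * M * (u * v * (u ^ 2 + u * v + v ^ 2) - 2 * M * (u + v) * (u ^ 2 + v ^ 2))|
        ≤ |u - v| * (21 / (8 * M ^ 3) * (u ^ 4 * v ^ 4)) :=
          mul_le_mul_of_nonneg_left (hA.trans hB) (abs_nonneg _)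
      _ = 21 / (8 * M ^ 3) * |u - v| * (u ^ 4 * v ^ 4) := by ring
  have huv : |u - v| ≤ |x - y| := abs_radius_sub_le hr x y
  calc |L * ((u - 2 * M) / u ^ 3) - 6 * M * (u - 2 * M) / u ^ 4
        - (L * ((v - 2 * M) / v ^ 3) - 6 * M * (v - 2 * M) / v ^ 4)|
      = |L * ((u - 2 * M) / u ^ 3 - (v - 2 * M) / v ^ 3)
          - (6 * M * (u - 2 * M) / u ^ 4 - 6 * M * (v - 2 * M) / v ^ 4)| := by ring_nf
    _ ≤ |L * ((u - 2 * M) / u ^ 3 - (v - 2 * M) / v ^ 3)|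
          + |6 * M * (u - 2 * M) / u ^ 4 - 6 * M * (v - 2 * M) / v ^ 4| := abs_sub _ _
    _ ≤ L * (5 / (8 * M ^ 3) * |u - v|) + 21 / (8 * M ^ 3) * |u - v| := by
        rw [abs_mul, abs_of_nonneg hL0]
        exact add_le_add (mul_le_mul_of_nonneg_left hF hL0) hG
    _ ≤ L * (5 / (8 * M ^ 3) * |x - y|) + 21 / (8 * M ^ 3) * |x - y| := by
        gcongr
    _ ≤ (L + 1) * (3 / M ^ 3) * |x - y| := by
        have hs : 0 ≤ |x - y| / M ^ 3 := by positivity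
        have e1 : L * (5 / (8 * M ^ 3) * |x - y|) + 21 / (8 * M ^ 3) * |x - y|
            = (5 * L + 21) / 8 * (|x - y| / M ^ 3) := by ring
        have e2 : (L + 1) * (3 / M ^ 3) * |x - y| = (3 * L + 3) * (|x - y| / M ^ 3) := by ring
        rw [e1, e2]
        exact mul_le_mul_of_nonneg_right (by linarith) hs

/-- **Explicit lower bound on the horizon side**: for `ρ ≥ 0`, every `ℓ` and
`x ∈ [x_c − ρ − 3, x_c − ρ]`,
`ℓ(ℓ+1) · e^{−(ρ+3)/(2M)}/(27 M²) − 1/M² ≤ V_ℓ(x)`. -/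
theorem potential_lower_near (hr : IsTortoiseRadius M r xc) {ρ : ℝ} (hρ : 0 ≤ ρ) (ℓ : ℕ)
    {x : ℝ} (hx : x ∈ Icc (xc - ρ - 3) (xc - ρ)) :
    (ℓ : ℝ) * ((ℓ : ℝ) + 1) * (Real.exp (-(ρ + 3) / (2 * M)) / (27 * M ^ 2)) - 1 / M ^ 2
      ≤ (1 - 2 * M / r x) *
        ((ℓ : ℝ) * ((ℓ : ℝ) + 1) / r x ^ 2 + (1 - ((2 : ℕ) : ℝ) ^ 2) * (2 * M) / r x ^ 3) := by
  have hM := hr.mass_pos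
  have hxc : x ≤ xc := hx.2.trans (by linarith)
  set u := r x with hu
  have hu2 : 2 * M < u := hr.two_mul_lt x
  have hu3 : u ≤ 3 * M := radius_le_three hr hxc
  have hu0 : 0 < u := by linarith
  set g := u - 2 * M with hg
  have hg0 : 0 < g := by rw [hg]; linarith
  have hgM : g ≤ M := by rw [hg]; linarith
  -- exponential lower bound on `g`
  have hexp : M * Real.exp (-(ρ + 3) / (2 * M)) ≤ g := by
    have h1 := radius_sub_ge_exp hr hxc
    refine le_trans ?_ h1
    refine mul_le_mul_of_nonneg_left (Real.exp_le_exp.2 ?_) hM.le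
    rw [div_le_div_iff_of_pos_right (by positivity)]
    linarith [hx.1]
  set L : ℝ := (ℓ : ℝ) * ((ℓ : ℝ) + 1) with hL
  have hL0 : 0 ≤ L := by positivity
  -- `V = L g/u³ − 6M g/u⁴`
  have hsplit : (1 - 2 * M / u) * (L / u ^ 2 + (1 - ((2 : ℕ) : ℝ) ^ 2) * (2 * M) / u ^ 3)
      = L * (g / u ^ 3) - 6 * M * g / u ^ 4 := by
    rw [hg]
    push_cast
    field_simp
    ring
  rw [hsplit]
  -- first term: `g/u³ ≥ M e^{…}/(27M³) = e^{…}/(27M²)`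
  have h1 : Real.exp (-(ρ + 3) / (2 * M)) / (27 * M ^ 2) ≤ g / u ^ 3 := by
    rw [div_le_div_iff₀ (by positivity) (by positivity)]
    have hu27 : u ^ 3 ≤ 27 * M ^ 3 := by
      calc u ^ 3 ≤ (3 * M) ^ 3 := pow_le_pow_left₀ hu0.le hu3 3
        _ = 27 * M ^ 3 := by ring
    calc Real.exp (-(ρ + 3) / (2 * M)) * u ^ 3
        ≤ Real.exp (-(ρ + 3) / (2 * M)) * (27 * M ^ 3) :=
          mul_le_mul_of_nonneg_left hu27 (Real.exp_pos _).le
      _ = (M * Real.exp (-(ρ + 3) / (2 * M))) * (27 * M ^ 2) := by ring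
      _ ≤ g * (27 * M ^ 2) := mul_le_mul_of_nonneg_right hexp (by positivity)
  -- second term: `6M g/u⁴ ≤ 6M·M/(2M)⁴ = 3/(8M²) ≤ 1/M²`
  have h2 : 6 * M * g / u ^ 4 ≤ 1 / M ^ 2 := by
    rw [div_le_div_iff₀ (by positivity) (by positivity), one_mul]
    have hu16 : (2 * M) ^ 4 ≤ u ^ 4 := pow_le_pow_left₀ (by linarith) hu2.le 4
    nlinarith [pow_pos hM 2, pow_pos hM 4, mul_le_mul_of_nonneg_left hgM (by positivity : (0:ℝ) ≤ 6 * M)]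
  have h1' : L * (Real.exp (-(ρ + 3) / (2 * M)) / (27 * M ^ 2)) ≤ L * (g / u ^ 3) :=
    mul_le_mul_of_nonneg_left h1 hL0
  linarith

end Summit.FinalStateConjecture.FinalStateConjecture.Theorems.UniformR

end
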